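import Mathlib
import Summits.Schanuel.Schanuel.Theorems.RigidCoreSchanuelOnLogFreeCoreDiazLadder
import Summits.Schanuel.Schanuel.Theorems.RigidCoreSchanuelOnLogFreeCoreDiazLadderCell
import Literature.NumberTheory.Transcendental.DiazMainHolds

/-!
# Line `sector-split` of crux `RigidCore.SchanuelOnLogFreeCore`: Diaz's Corollaire 1 at core points

Registered stub C8 `stub_diazLadder_anyCoreBase` of line `sector-split` of crux
`stmt-Schanuel-0970` (`Summit.Schanuel.Schanuel.Theses.RigidCore.SchanuelOnLogFreeCore`, (R):
Schanuel's conjecture for `ℚ`-linearly independent tuples drawn from the log-free core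
`C_EA = sInf {K ≤ ℂ | 2πi ∈ K, K exp-closed, K relatively algebraically closed}`).

This is a CALIBRATION of (R), not progress on it.  For `β` algebraic of degree `d ≥ 2` over `ℚ`
and ANY nonzero `l ∈ C_EA`, the full ladder `x = (β^k · l)_{0 ≤ k < d}` is

1. a CORE tuple: `β ∈ ℚ̄ ⊆ M ⊆ C_EA` (`mem_kernelFreeCore_of_isAlgebraic_rat`,
   `CalibrationB.kernelFreeCore_le_logFreeCore`) and `C_EA` is a field, so `β^k · l ∈ C_EA`;
2. `ℚ`-linearly independent: a relation `∑ c_k β^k l = 0` with `l ≠ 0` is a vanishing rational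
   combination of the powers `β^0, …, β^{d-1}`, which are `ℚ`-free (`linearIndependent_pow`,
   `d = deg β`), hence `c = 0`;
3. of unconditional transcendence degree `trdeg_ℚ ℚ(x, eˣ) ≥ ⌊(d+1)/2⌋`: Diaz 1989,
   Corollaire 1 (the Gel'fond ladder at an ARBITRARY base `a = e^l` with the logarithm `l`),
   PROVED in the tree as `Literature.NumberTheory.Transcendental.Diaz1989_cor1_holds`, bounds
   `trdeg_ℚ ℚ(e^{β^k l} : k < d)` from below, and `{e^{β^k l}} = {e^{x_k}} ⊆ {x} ∪ {eˣ}`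
   (monotonicity `DiazLadder.trdeg_adjoin_mono`).

So (R) demands `d` on this cell (skeleton: `diazLadder_anyCoreBase_demand_of_crux`) while
`⌊(d+1)/2⌋` is settled — Gel'fond–Diaz half-credit through EVERY core point (the sibling files
`…DiazLadder.lean`, `…DiazLadderCell.lean` treat the base `l = rπi`).  Instances recorded below:
`d = 3` ("two of `e^l, e^{βl}, e^{β²l}` are algebraically independent"), the concrete cubic
`β = 2^{1/3}` (`DiazLadder.natDegree_minpoly_two_cpow_third`), and the core point `l = e`:
two of `e^e, e^{∛2·e}, e^{∛4·e}` are algebraically independent.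

All auxiliaries live in the sub-namespace
`Summit.Schanuel.Schanuel.Theorems.RigidCore.DiazAnyBase`; only the registered stub
`stub_diazLadder_anyCoreBase` is declared directly in `Summit.Schanuel.Schanuel.Theorems.RigidCore`
(with the crux's `sInf` verbatim; it is `logFreeCore` by `rfl`).

Sources: G. Diaz, *Grands degrés de transcendance pour des familles d'exponentielles*,
J. Number Theory 31 (1989) 1–23, Corollaire 1 (p. 3) — entering only through the tree theorem
`Diaz1989_cor1_holds`; everything else is Mathlib (`linearIndependent_pow`, `minpoly`,
`Algebra.trdeg`) and the tree's objects `logFreeCore`, `kernelFreeCore` with their API.  No new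
definitions, no hypotheses of `Prop`-valued definitions.
-/

noncomputable section

namespace Summit.Schanuel.Schanuel.Theorems.RigidCore

open Complex IntermediateField
open Summit.Schanuel.Schanuel.Theorems.AclSubsetLogFreeCore.Negative
open Literature.NumberTheory.Transcendental

namespace DiazAnyBase

/-! ## Helpers -/

/-- The rungs of the ladder through a core point lie in the log-free core: `β^m · l ∈ C_EA` for
`β` algebraic and `l ∈ C_EA` (`ℚ̄ ⊆ M ⊆ C_EA` and `C_EA` is a field). [folklore] -/
theorem ladder_mem_logFreeCore {β l : ℂ} (hβ : IsAlgebraic ℚ β) (hl : l ∈ logFreeCore) (m : ℕ) :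
    β ^ m * l ∈ logFreeCore :=
  mul_mem (pow_mem (CalibrationB.kernelFreeCore_le_logFreeCore
    (mem_kernelFreeCore_of_isAlgebraic_rat hβ)) m) hl

/-- **The ladder at a nonzero base is `ℚ`-free.**  If `deg (minpoly ℚ β) = d`, `l ≠ 0` and
`x_k = β^k · l` (`k < d`), then `x` is `ℚ`-linearly independent: a relation `∑ c_k x_k = 0` reads
`(∑ c_k β^k) · l = 0`, so `∑ c_k β^k = 0`, a vanishing `ℚ`-combination of the linearly
independent powers `β^0, …, β^{d-1}` (`linearIndependent_pow`). [folklore] -/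
theorem ladder_linearIndependent {β l : ℂ} {d : ℕ} (hd : (minpoly ℚ β).natDegree = d)
    (hl0 : l ≠ 0) (x : Fin d → ℂ) (hx : ∀ k, x k = β ^ (k : ℕ) * l) :
    LinearIndependent ℚ x := by
  subst hd
  rw [Fintype.linearIndependent_iff]
  intro g hg
  have hsum : ∑ i, g i • x i = (∑ i, (g i : ℂ) * β ^ (i : ℕ)) * l := by
    rw [Finset.sum_mul]
    refine Finset.sum_congr rfl fun i _ => ?_
    rw [hx i, Rat.smul_def, mul_assoc]
  have h0 : ∑ i, (g i : ℂ) * β ^ (i : ℕ) = 0 :=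
    (mul_eq_zero.mp (hsum ▸ hg)).resolve_right hl0
  exact Fintype.linearIndependent_iff.mp (linearIndependent_pow (K := ℚ) β) g
    (by simpa only [Rat.smul_def] using h0)

/-- **Diaz's count on the ladder at an arbitrary nonzero base.**  If `deg (minpoly ℚ β) = d ≥ 2`,
`l ≠ 0` and `x_k = β^k · l` (`k < d`), then `trdeg_ℚ ℚ(x, eˣ) ≥ ⌊(d+1)/2⌋`: Diaz's
Corollaire 1 (`Diaz1989_cor1_holds`, base `a = e^l`, logarithm `l`) bounds
`trdeg_ℚ ℚ(e^{β^k l} : k < d)`, and `e^{β^k l} = e^{x_k}` generate a subfield of `ℚ(x, eˣ)`.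
[cite: Diaz1989, Corollaire 1, p. 3] -/
theorem le_trdeg_of_ladder {β l : ℂ} {d : ℕ} (hd : (minpoly ℚ β).natDegree = d) (h2 : 2 ≤ d)
    (hl0 : l ≠ 0) (x : Fin d → ℂ) (hx : ∀ k, x k = β ^ (k : ℕ) * l) :
    (((d + 1) / 2 : ℕ) : Cardinal) ≤
      Algebra.trdeg ℚ ↥(adjoin ℚ (Set.range x ∪ Set.range (cexp ∘ x))) := by
  refine (Diaz1989_cor1_holds (cexp l) β l d hd h2 rfl hl0).trans
    (DiazLadder.trdeg_adjoin_mono ?_)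
  rintro _ ⟨k, rfl⟩
  exact Or.inr ⟨k, by rw [Function.comp_apply, hx k]⟩

end DiazAnyBase

/-! ## The registered stub -/

/-- **Registered stub C8 `stub_diazLadder_anyCoreBase` of line `sector-split` (signature
verbatim).**  For every nonzero `l` in the log-free core
`C_EA = sInf {K ≤ ℂ | 2πi ∈ K, K exp-closed, K relatively algebraically closed}` and every `β`
with `deg_ℚ β = d ≥ 2`, the ladder `x = (β^k · l)_{0 ≤ k < d}` consists of core elements
(`β^k ∈ ℚ̄ ⊆ C_EA`, `C_EA` a field), is `ℚ`-linearly independent (`l ≠ 0` and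
`1, β, …, β^{d-1}` are `ℚ`-free), and unconditionally
`⌊(d+1)/2⌋ ≤ trdeg ℚ(e^{β^k l} : k < d) ≤ trdeg ℚ(x, eˣ)` (Diaz 1989, Corollaire 1, at base
`a = e^l` with logarithm `l`, tree theorem `Diaz1989_cor1_holds`; monotonicity of
`trdeg ∘ adjoin`).  Proof: `DiazAnyBase.ladder_mem_logFreeCore`,
`DiazAnyBase.ladder_linearIndependent`, `DiazAnyBase.le_trdeg_of_ladder`.
[cite: Diaz1989, Corollaire 1, p. 3] -/
theorem stub_diazLadder_anyCoreBase :
    ∀ (β l : ℂ) (d : ℕ), (minpoly ℚ β).natDegree = d → 2 ≤ d →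
      l ∈ (sInf {K : IntermediateField ℚ ℂ | (2 * ↑Real.pi * Complex.I : ℂ) ∈ K ∧
        (∀ w ∈ K, Complex.exp w ∈ K) ∧ ∀ w : ℂ, IsAlgebraic K w → w ∈ K} : IntermediateField ℚ ℂ) →
      l ≠ 0 →
      ∀ x : Fin d → ℂ, (∀ k, x k = β ^ (k : ℕ) * l) →
        (∀ k, x k ∈ (sInf {K : IntermediateField ℚ ℂ | (2 * ↑Real.pi * Complex.I : ℂ) ∈ K ∧
          (∀ w ∈ K, Complex.exp w ∈ K) ∧ ∀ w : ℂ, IsAlgebraic K w → w ∈ K} : IntermediateField ℚ ℂ)) ∧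
        LinearIndependent ℚ x ∧
        (((d + 1) / 2 : ℕ) : Cardinal) ≤ Algebra.trdeg ℚ
          ↥(IntermediateField.adjoin ℚ (Set.range x ∪ Set.range (Complex.exp ∘ x))) := by
  intro β l d hd h2 hl hl0 x hx
  refine ⟨fun k => ?_, DiazAnyBase.ladder_linearIndependent hd hl0 x hx,
    DiazAnyBase.le_trdeg_of_ladder hd h2 hl0 x hx⟩
  rw [hx k]
  exact DiazAnyBase.ladder_mem_logFreeCore
    (DiazLadder.isAlgebraic_of_natDegree_minpoly hd h2) hl _

namespace DiazAnyBase

/-! ## Instances -/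

/-- **Diaz's Corollaire 1 at `d = 3`:** for `β` cubic (`deg (minpoly ℚ β) = 3`) and any `l ≠ 0`,
two of the three numbers `e^l, e^{βl}, e^{β²l}` are algebraically independent, i.e.
`trdeg_ℚ ℚ(e^{β^k l} : k < 3) ≥ 2 = ⌊(3+1)/2⌋`. [cite: Diaz1989, Corollaire 1, p. 3] -/
theorem two_le_trdeg_exp_ladder_cubic (β l : ℂ) (hd : (minpoly ℚ β).natDegree = 3)
    (hl0 : l ≠ 0) :
    (2 : Cardinal) ≤ Algebra.trdeg ℚ
      ↥(adjoin ℚ (Set.range fun k : Fin 3 => Complex.exp (β ^ (k : ℕ) * l))) := by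
  have h := Diaz1989_cor1_holds (cexp l) β l 3 hd (by norm_num) rfl hl0
  simpa using h

/-- **The cubic core cell at an arbitrary core base**: for `β` cubic and any nonzero `l`, the
ladder `x = (l, βl, β²l)` has `trdeg_ℚ ℚ(x, eˣ) ≥ 2` — two thirds of the (R)-demand `3` when
`l ∈ C_EA`. [cite: Diaz1989, Corollaire 1, p. 3] -/
theorem cruxCell_cubic (β l : ℂ) (hd : (minpoly ℚ β).natDegree = 3) (hl0 : l ≠ 0)
    (x : Fin 3 → ℂ) (hx : ∀ k, x k = β ^ (k : ℕ) * l) :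
    (2 : Cardinal) ≤
      Algebra.trdeg ℚ ↥(adjoin ℚ (Set.range x ∪ Set.range (Complex.exp ∘ x))) := by
  have h := le_trdeg_of_ladder hd (by norm_num) hl0 x hx
  simpa using h

/-- **The concrete cell `β = 2^{1/3}` at an arbitrary nonzero base `l`**
(`deg (minpoly ℚ 2^{1/3}) = 3`, `DiazLadder.natDegree_minpoly_two_cpow_third`): two of
`e^l, e^{∛2·l}, e^{∛4·l}` are algebraically independent. [cite: Diaz1989, Corollaire 1, p. 3] -/
theorem two_le_trdeg_exp_ladder_twoCpowThird (l : ℂ) (hl0 : l ≠ 0) :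
    (2 : Cardinal) ≤ Algebra.trdeg ℚ
      ↥(adjoin ℚ (Set.range fun k : Fin 3 =>
        Complex.exp (((2 : ℂ) ^ (1 / 3 : ℂ)) ^ (k : ℕ) * l))) :=
  two_le_trdeg_exp_ladder_cubic _ l DiazLadder.natDegree_minpoly_two_cpow_third hl0

/-- `e = exp 1` lies in the log-free core (`1 ∈ C_EA` and `C_EA` is `exp`-closed). [folklore] -/
theorem exp_one_mem_logFreeCore : cexp 1 ∈ logFreeCore :=
  logFreeCore_mem_coreFamily.2.1 1 (one_mem _)

/-- **The core point `l = e`, `β = 2^{1/3}`:** two of `e^e, e^{∛2·e}, e^{∛4·e}` are algebraically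
independent (Diaz's Corollaire 1 at the base `a = e^e` with logarithm `e ≠ 0`), a settled
two-thirds of the (R)-cell `x = (e, ∛2·e, ∛4·e)` of the log-free core.
[cite: Diaz1989, Corollaire 1, p. 3] -/
theorem two_le_trdeg_exp_ladder_twoCpowThird_exp_one :
    (2 : Cardinal) ≤ Algebra.trdeg ℚ
      ↥(adjoin ℚ (Set.range fun k : Fin 3 =>
        Complex.exp (((2 : ℂ) ^ (1 / 3 : ℂ)) ^ (k : ℕ) * cexp 1))) :=
  two_le_trdeg_exp_ladder_twoCpowThird _ (Complex.exp_ne_zero 1)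

/-- **The core cell `x = (e, ∛2·e, ∛4·e)` of (R)**: its rungs lie in `C_EA`, it is `ℚ`-free, (R)
demands `3` on it, and `2 ≤ trdeg_ℚ ℚ(x, eˣ)` holds unconditionally (the registered stub at
`β = 2^{1/3}`, `l = e`). [cite: Diaz1989, Corollaire 1, p. 3] -/
theorem cruxCell_twoCpowThird_exp_one (x : Fin 3 → ℂ)
    (hx : ∀ k, x k = ((2 : ℂ) ^ (1 / 3 : ℂ)) ^ (k : ℕ) * cexp 1) :
    (∀ k, x k ∈ logFreeCore) ∧ LinearIndependent ℚ x ∧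
      (2 : Cardinal) ≤
        Algebra.trdeg ℚ ↥(adjoin ℚ (Set.range x ∪ Set.range (Complex.exp ∘ x))) := by
  obtain ⟨hmem, hfree, hdeg⟩ := stub_diazLadder_anyCoreBase _ (cexp 1) 3
    DiazLadder.natDegree_minpoly_two_cpow_third (by norm_num) exp_one_mem_logFreeCore
    (Complex.exp_ne_zero 1) x hx
  exact ⟨hmem, hfree, by simpa using hdeg⟩

end DiazAnyBase

end Summit.Schanuel.Schanuel.Theorems.RigidCore

end
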